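import Summits.QuantumFields.YangMills.Theorems.BalabanUVNodesK0AxJoinResidualBox
import Summits.QuantumFields.YangMills.Theorems.BalabanUVNodesK0AxTangentSocketOntoModGauge
import Summits.QuantumFields.YangMills.Theorems.BalabanUVNodesPortU8LocResponse

/-!
# P3 g92 №20 — THE BOX ROAD's (R-Bg) AND (R-Orb) DISSOLVE INTO THE SCHEME-OF-RECORD TOKENS; THE TOKEN IS `TokP9L4Old` ITSELF — LENS P3 «weaken the target»

LANDING NOTE (porter ▶ PTC-1 g4, 2026-08-31; AUTHORSHIP = ★ P3 g92 «weaken the target», HOME sketch `nodeO-cover/P3-BoxRoadSchemeTokens-v1.lean` sha16 dc932b81311252fb · 370 l. · 5 thm, no def, 0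
sorry (№20: on the K0ᴬ BOX road the token IS `TokP9L4Old` itself, (R-Bg) and the (C-orb) rows are COROLLARIES of the scheme-of-record token package (R-Sch) via ✓p823633's `_recordScheme_modGauge`
chain read at `n = ω`, so the road displays {⁸, (R-Uk), (R-Old), (R-Sch)} (+ cofinal ⁸, (R-Win₁) at the junction) — one Bałaban-strength receipt fewer)): landed VERBATIM (only this paragraph
added) under P3's basename (`…Theorems/BalabanUVNodesK0AxJoinResidualBoxScheme.lean`, ns `…Theorems.K0AxJoinResidualBoxScheme`) as INTENT-78; imports ✓p823207 `…K0AxJoinResidualBox` + ✓p823633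
`…K0AxTangentSocketOntoModGauge` + ✓`…PortU8LocResponse` (independent of №19); `--supports stmt-QuantumFields-27238 --as helper` (NO `--workitem`; kind proof); ◆ CRIT-1 g38's cut: «(a) CUT — №20 →
GO VERBATIM; 5 thm ∕ 0 def; axioms standard on 5 guarded names + a K0ᴬ-door `example`; J4 5 × 0; J5′: no `def : Prop`, no bridge; hSch's `covers` conjunct is the OrbitRel `_modGauge` edition (NOT
the dead flat dictionary); (D) `analyticAt_recordBgField_entries_of_tokens_recordScheme` checked at the type = ⁸'s antecedent-12 expression; SAME-WALL: LENS-P3 door re-cut, S∕M bookkeeping —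
(R-Bg) and (R-Orb) become kernel READS of (R-Sch)» (nodeO STATUS 2026-08-31T14:33:29Z).  HONEST (porter): CONDITIONAL doors (audit `proof.conditional` ∕ support; credit nothing); ⁸'s box texts
signed NOWHERE; (R-Uk) ∕ (R-Old) ∕ (R-Sch) ∕ (R-Win₁) OPEN Bałaban-strength content inhabited NOWHERE as a package; nothing of Bałaban asserted, ported, discharged or refuted; K0ᴬ
stmt-QuantumFields-27238 ∕ K1ᴬ 27239 OPEN — NOTHING of them proved; NODE O 0∕1; COUNT 8∕28 · K 1∕4 UNMOVED; finite 𝕋⁴ at fixed ε — NOT continuum ∕ OS ∕ Clay; the Yang–Mills mass gap is NOT proved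
by any of this.

ym-nodeO-ideate ★ P3 g92 (count-neutral author seat; sketch OFFERED to ◆ CRIT-1 ∕ ▶ PTC-1 — P3 files nothing).  WHAT THIS FILE DOES, exactly.  After ✓№18
(`…K0AxJoinResidualBox`: K0ᴬ ⟸ ⁸-on-the-box ∧ (R-Uk) ∧ (R-Bg) ∧ (R-Tok) ∧ (C-orb)♭, junction `hβc` likewise + window letters) and №19 (ceiling-and-floor shape of
(C-orb)♭ =: (R-Orb) and of the window =: (R-Win₁)), the box road displayed FIVE Bałaban-strength receipts: ⁸, (R-Uk), (R-Bg), (R-Tok) with its bridge `hBr : Tok → TokP9L4Old`,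
(R-Orb).  Three observations, typed:
(A) THE TOKEN.  On the box road `Tok` is consumed ONLY through `hBr F Mc a₀ hP9` into ⁸'s thirteenth antecedent `TokP9L4Old F Mc a₀` (✓`…K0AxDoorOfSig8Box` :59, ✓№18 :115∕:238):
    the weakest token is `TokP9L4Old` itself (`Tok := TokP9L4Old`, `hBr := id`); the T‴∕G₄ tokens (`TokP9L4New`, `Tok182`, `TokCmpUcap`) are NOT on the box road.  §4 pins it; the
    generic `(Tok, hBr, hTok)` editions (✓№18∕№19's interface) follow from §4 by `hOld := fun F => (hTok F).imp fun _ h => ⟨h.1, fun a₀ h₀ hle =>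
    (h.2 a₀ h₀ hle).imp fun _ hM Mc hG hMc => hBr F Mc a₀ (hM Mc hG hMc)⟩` (one line each; omitted for the 400-line cap) — pinning loses nothing.
(D) (R-Bg) IS A COROLLARY OF THE SCHEME TOKENS.  ⁸'s twelfth antecedent — TokP9reg, `AnalyticAt ℝ (B ↦ (U_{k+1}(W_B)(b))_{b}) 0` at the record's fill — follows from the SAME
    scheme-of-record token package that lens-1∕def-Y's ✓`K0AxCtabUniq.rootedReceipts_of_tokens_atScale_recordScheme_modGauge` (✓p823633) reads for the rooted receipts: that
    file's chain is typed at EVERY order `n : WithTop ℕ∞` (✓`contDiffAt_lieExpo_unitField_ofRecord_of_exp_mem`, ✓`contDiffAt_coe_expChart_family`,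
    ✓`contDiffAt_recordBgField_entries_of_chart`), its final merely READS `n = 2`; at `n = ω` Mathlib's `ContDiffAt.analyticAt` gives TokP9reg (§1, general datum `θ` with
    `ρ₈ ∈ 𝔰𝔲(2)`).  (On the ⁸ road itself TokP9reg is consumed by the PROVED frame ✓`formatPlusG_recordJ_of_wrapAwareResidue` only at CONTINUITY strength, through
    ✓`PortS1Selector.eventually_norm_recordBgField_sub_one_le`; the analytic strength stays available verbatim to the open residue supplier of ✓`sig27930v8LR4_of_residueW`.)
(B) (R-Orb) IS A COROLLARY OF THE SAME TOKENS (✓p823633's `.2.1` component at `θ := thetaFill F a₀ ε₂₉`, `K := recordK₀ F Mc k + n`; `ρ₈ ∈ 𝔰𝔲(2)` there is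
    ✓`PortU8.ρ8_thetaFill_mem_lieSU`; `k + 2 ≤ m + K` is automatic from `1 ≤ m` (`T4Family.hm`) and `recordK₀ = k + 1 + log_L Mc`; the four `Fact`s are the Node00 THEOREMS
    ✓`factL` ✓`factEta` ✓`factC0` ✓`wBRec_fact`, bound with `haveI`) — §2.
HENCE (R-Sch) — the scheme-of-record token package in ceiling-and-floor shape `∀ F, ∃ aS > 0, ∀ a₀ ∈ ]0, aS], ∃ M₀, ∀ Mc, McGuard → M₀ ≤ Mc → ∀ ε₂₉ > 0, ∀ k n, ∃ (the scheme data
Ω dom levB Gp Δ2 a hposπ hposb hQ εC B₀ C₄ a₃ j a𝔄 ε₄, S = bgSchemeOfRecord …, Kc), RegimeTok ∧ WAnalyticTok ∧ 0 < a𝔄 ∧ dom ∈ 𝓝 1 ∧ (rng) ∧ (cov) ∧ (c→s) ∧ (min) ∧ (min⋆) ∧ (Lie token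
eventually along W_B)` (binders VERBATIM ✓p823633) — SUPPLIES BOTH (R-Bg) and (R-Orb) (§3), and the doors read (§4):
    ★★★ K0ᴬ BY NAME ⟸ ⁸-on-the-box ∧ (R-Uk) ∧ (R-Old) ∧ (R-Sch);   ★★★ junction `hβc` VERBATIM ⟸ cofinal ⁸ ∧ (R-Uk) ∧ (R-Old) ∧ (R-Sch) ∧ (R-Win₁)
((R-Old) := `TokP9L4Old` below a family radius, above a cube-letter floor).  Proofs = №19's compositions verbatim with `hBg F`, `hOrbC F` replaced by §3's two projections of
`hSch F` and `hBr F Mc a₀ hP9` by `hP9` — pure composition, no re-run of ✓g88 ∕ ✓№16 ∕ ✓№10.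
EDGE CONTENT (LENS-P3 decision table, box road, after №20): K0ᴬ ⟸ {⁸ `Sig8LR4Box`, (R-Uk) = [15] Thm 1 (8)–(9) at the record volumes, (R-Old) = print's (1.22) token, (R-Sch) = the N07∕def-Y
KNIT token package OF THE RECORD's OWN SCHEME}; junction `hβc` ⟸ the same ∪ {cofinal ⁸, (R-Win₁)}.  (R-Bg) and the abstract orbit row (R-Orb) are NO LONGER displayed binders of the box
road: both are READ from (R-Sch) by kernel-checked theorems.  located-B = ∅; bare-∀-radius binders = ∅; every displayed binder is a NAMED token of a NAMED tree object.

HONEST FRAMING.  CONDITIONAL doors (kernel-checked implications between DISPLAYED rows; audit `proof.conditional` ∕ support, credits nothing); NOTHING of Bałaban is asserted, ported,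
discharged or refuted; ⁸'s box texts signed NOWHERE; (R-Uk) ∕ (R-Old) ∕ (R-Sch) ∕ (R-Win₁) are OPEN Bałaban-strength content ([15] Thm 1 (8)–(9), Props. 4, 6, 7, 9, (15), (19)–(20),
(44)–(48), (82)–(83), (176)–(182); [I] (1.22), §1∕§5 + AF sign) inhabited NOWHERE as packages; K0ᴬ stmt-QuantumFields-27238 OPEN — NOTHING of it proved; K1ᴬ 27239 ∕ K3ᴬ 27247 ∕
⟨27930⟩ OPEN; NODE O `B13TermWalkDataOneTorus.ExistsUniformAcrossSmall` NOT inhabited (0∕1); COUNT 8∕28 · K 1∕4 UNMOVED; finite `𝕋⁴_{L^K}` at fixed ε — NOT continuum ∕ ℝ⁴ ∕ OS;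
R4 = the conditional `BalabanLadder.UV` rung only; **the Yang–Mills mass gap (Clay) is NOT proved by any of this.**  No `sorry`, no `def`, no `instance`, no `notation`; standard axioms.

References: T. Bałaban, *Renormalization group approach to lattice gauge field theories. I*, Comm. Math. Phys. 109 (1987) 249–301 [Balaban1987RG1] — Thm 1 p.259, Thm 2 (0.31) p.259,
Thm 3 p.264, (1.18)–(1.22) pp.263–264, (2.3) p.265, (4.35)–(4.37) pp.290–291, (5.10) p.293, (5.38)–(5.44) pp.296–297; T. Bałaban, *The variational problem and background fields in
renormalization group method for lattice gauge theories*, Comm. Math. Phys. 102 (1985) 277–309 [Balaban1985Variational] — Thm 1 (8)–(9) p.279, (15) p.280, (19)–(20) p.281, (44)–(48)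
p.285, Prop. 4 p.292, Prop. 6 (115)–(117) p.295, Prop. 7 p.299, Prop. 9 p.309, (176)–(182) pp.306–307; T. Bałaban, *Propagators and renormalization transformations for lattice gauge
theories. I*, Comm. Math. Phys. 95 (1984) 17–40 [Balaban1985BackgroundPropagators] — (3.11) p.392, (3.16) p.393.
-/

open Filter Topology
open scoped BigOperators Matrix.Norms.L2Operator
open scoped InnerProductSpace

namespace Summit.QuantumFields.YangMills.Theorems.K0AxJoinResidualBoxScheme

open Literature.MathematicalPhysics.QuantumFieldTheory.Balaban1983to89
open Literature.MathematicalPhysics.QuantumFieldTheory.Balaban1983to89.Node00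
open Literature.MathematicalPhysics.QuantumFieldTheory.Balaban1983to89.T4Continuum (T4Family)
open Literature.MathematicalPhysics.QuantumFieldTheory.Balaban1983to89.B12FormatPlus
open Literature.MathematicalPhysics.QuantumFieldTheory.Balaban1983to89.FlowStep
open Literature.MathematicalPhysics.QuantumFieldTheory.Balaban1983to89.FlowStepRuns
open B12GaugeOrbits021 (OrbitRel)
open B11Prop6Scheme (mapT)
open B11Eq103H1Complex (BondL2K SiteL2K)
open T4AdjointCovarianceUnitary (lieSU exp_mem_specialUnitaryGroup_of_mem_lieSU)
open Summit.QuantumFields.YangMills.Theorems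
open Summit.QuantumFields.YangMills.Theorems.K0RecordFormatNames
open Summit.QuantumFields.YangMills.Theorems.K0AxMomentRoad
open Summit.QuantumFields.YangMills.Theorems.PortHRecordJoin
open Summit.QuantumFields.YangMills.Theorems.BalabanUVNodesPortS1 (Sig8LR4Box)
open Summit.QuantumFields.YangMills.Theorems.K0AxChartRowsOfOrbit (chartRowsBox_of_orbit)
open Summit.QuantumFields.YangMills.Theorems.K0AxJunctionWindow (Sig8LR4BoxBelow)
open Summit.QuantumFields.YangMills.Theorems.K0AxJoinResidualBox (joinAntecedentsRadiusFirst_of_residual)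

/-! ## §1  (D) TokP9reg — ANALYTICITY of `B ↦ (U_{k+1}(W_B)(b))_b` at `0` — from the scheme-of-record tokens, general datum `θ` with `ρ₈ ∈ 𝔰𝔲(2)` -/

/-- ★★★ **TokP9reg (⁸'s twelfth antecedent, [15] Prop. 9's analyticity) FROM THE SCHEME-OF-RECORD TOKEN PACKAGE** — binders VERBATIM ✓`K0AxCtabUniq.rootedReceipts_of_tokens_atScale_recordScheme_modGauge`
(✓p823633).  Chain, all tree theorems typed at every order `n : WithTop ℕ∞` and read here at `n = ω`: KNIT tokens + `RegimeTok` + domain letter ⟹ factorisation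
(✓`rootFactorAt_of_tokens_chart`); the Lie token ⟹ (s-exp) `chartCfg S (W_B) = expChart 1 (lieExpo S (W_B))` near `0` (✓`chartCfg_unitField_eventuallyEq_expChart_ofRecord`); `RegimeTok`,
`1 ∈ dom`, `WAnalyticTok`, `0 < a𝔄`, `exp (ρ₈ v) ∈ SU(2)` ⟹ `lieExpo S ∘ W` is `C^ω` at `0` (✓`contDiffAt_lieExpo_unitField_ofRecord_of_exp_mem`); ⟹ `C^ω` entries of the rooted background field
(✓`contDiffAt_coe_expChart_family`, ✓`rootFactorAt_congr`, ✓`contDiffAt_recordBgField_entries_of_chart`); `C^ω ⟹ analytic` (Mathlib `ContDiffAt.analyticAt`).  CONDITIONAL on the displayed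
tokens (inhabited nowhere as a package); nothing of [15] asserted. [cite: Balaban1985Variational, Prop. 9 p.309, Prop. 6 (115)–(117) p.295, Prop. 4 p.292, (15) p.280, (19)–(20) p.281,
(176)–(178) p.306; Balaban1987RG1, (1.22) p.264, (2.3) p.265, (4.35) p.290] -/
theorem analyticAt_recordBgField_entries_of_tokens_recordScheme (F : T4Family) (θ : Stage13Params F 2) (k K : ℕ) (hk2 : k + 2 ≤ (F.P K).m + (F.P K).K)
    [Fact (0 < (F.L : ℝ))] [Fact (0 < (F.P K).eta (k + 1))] [Fact (0 < c0Rec F K (k + 1))] [Fact (∀ c, 0 < wBRec F K (k + 1) c)]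
    (Ω : ℕ → Set (Site (F.P K) 0)) (dom : Set (GaugeField (F.P K) (k + 1) (SU 2))) (levB : PBond (F.P K) (k + 1) → ℕ)
    (Gp : SiteL2K ℂ (F.P K).d (fun _ => (F.P K).sitesPerDir 0) (c0Rec F K (k + 1)) (WRec 2) →ₗ[ℂ]
      SiteL2K ℂ (F.P K).d (fun _ => (F.P K).sitesPerDir 0) (c0Rec F K (k + 1)) (WRec 2))
    (Δ2 : BondL2K ℂ (F.P K).d (fun _ => (F.P K).sitesPerDir 0) (c0Rec F K (k + 1)) (WRec 2) →ₗ[ℂ]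
      BondL2K ℂ (F.P K).d (fun _ => (F.P K).sitesPerDir 0) (c0Rec F K (k + 1)) (WRec 2)) (a : ℝ)
    (hposπ : ∀ x, x ≠ 0 → 0 < RCLike.re ⟪x, laplaceAOfRecordAt F 2 (k + 1) (1 : GaugeField (F.P K) 0 (SU 2))
      (hessOpOfRecord128 F 2 (k + 1) (1 : GaugeField (F.P K) 0 (SU 2)) Gp (QflatOfRecord F 2 (k + 1)) Δ2)
      (QOfRecord F 2 (k + 1) (1 : GaugeField (F.P K) 0 (SU 2))) (QflatOfRecord F 2 (k + 1)) a x⟫_ℂ)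
    (hposb : ∀ x, x ≠ 0 → 0 < RCLike.re ⟪x, laplaceAOfRecord F 2 (k + 1) (1 : GaugeField (F.P K) 0 (SU 2))
      (QOfRecord F 2 (k + 1) (1 : GaugeField (F.P K) 0 (SU 2))) (QflatOfRecord F 2 (k + 1)) a x⟫_ℂ)
    (hQ : Function.Surjective (QOfRecord F 2 (k + 1) (1 : GaugeField (F.P K) 0 (SU 2)))) (εC B₀ C₄ a₃ j a𝔄 ε₄ : ℝ)
    (S : BgSchemeOnLit F 2 K (k + 1) Ω 1) (hS : S = bgSchemeOfRecord F 2 K (k + 1) Ω 1 dom levB Gp Δ2 a hposπ hposb hQ εC B₀ C₄ a₃ j a𝔄 ε₄)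
    (hT : S.RegimeTok) (hWtok : WAnalyticTok F 2 K (k + 1) Ω 1 levB Gp a hposb hQ εC a₃) (ha𝔄 : 0 < a𝔄)
    (hd : dom ∈ 𝓝 (1 : GaugeField (F.P K) (k + 1) (SU 2)))
    (hρ8 : letI := θ.instVβ₁; letI := θ.instVβ₂; ∀ v : θ.Vβ, θ.ρ8 v ∈ lieSU (Fin 2))
    (Kc : GaugeField (F.P K) (k + 1) (SU 2) → Set (Space115Lit F 2 K (k + 1) Ω 1))
    (range : ∀ V ∈ S.dom, ∀ A ∈ Kc V, S.chart V A ∈ bgReg F 2 K (k + 1) θ.εbg ∧ Averaging.iter (avOfRecord F 2 K) (k + 1) (S.chart V A) = V)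
    (covers : ∀ V ∈ S.dom, ∀ U : GaugeField (F.P K) 0 (SU 2), U ∈ bgReg F 2 K (k + 1) θ.εbg →
      Averaging.iter (avOfRecord F 2 K) (k + 1) U = V → ∃ A ∈ Kc V, OrbitRel (k + 1) (S.chart V A) U)
    (sol_of_isMinOn : ∀ V ∈ S.dom, ∀ A ∈ Kc V, IsMinOn (wilsonAction4 ∘ S.chart V) (Kc V) A →
      ‖A‖ ≤ S.ε₄ ∧ mapT (S.𝒢 V) 0 (S.W V) (S.J V) (S.𝔄 V) A = A)
    (star_mem : ∀ V ∈ S.dom, S.sol V ∈ Kc V) (star_isMinOn : ∀ V ∈ S.dom, IsMinOn (wilsonAction4 ∘ S.chart V) (Kc V) (S.sol V))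
    (htok : letI := θ.instVβ₁; letI := θ.instVβ₂;
      ∀ᶠ B in 𝓝 (0 : Fin (F.P K).d → Site (F.P K) (k + 1) → θ.Vβ), S.LieTokAt (unitField F θ k K B)) :
    letI := θ.instVβ₁; letI := θ.instVβ₂
    AnalyticAt ℝ (fun B : Fin (F.P K).d → Site (F.P K) (k + 1) → θ.Vβ =>
      fun (b : PBond (F.P K) 0) (i i' : Fin 2) => ((recordBgField F θ k K B b : SU 2) : Matrix (Fin 2) (Fin 2) ℂ) i i') 0 := by
  letI := θ.instVβ₁; letI := θ.instVβ₂
  subst hS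
  have hk : k + 1 ≤ (F.P K).m + (F.P K).K := by omega
  have h1 : (1 : GaugeField (F.P K) (k + 1) (SU 2)) ∈ dom := mem_of_mem_nhds hd
  have hρ : ∀ v : θ.Vβ, NormedSpace.exp (θ.ρ8 v) ∈ Matrix.specialUnitaryGroup (Fin 2) ℂ :=
    fun v => exp_mem_specialUnitaryGroup_of_mem_lieSU (hρ8 v)
  -- factorisation `recordBgField B = rootGauge (chartCfg S (W_B))` near `0`, from the KNIT tokens
  have hfac := K0AxCtabUniq.rootFactorAt_of_tokens_chart F θ k K hk _ hT Kc range covers sol_of_isMinOn star_mem star_isMinOn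
    (K0AxCtabUniq.eventually_unitField_mem F θ k K hρ hd)
  -- (s-exp) near `0`, from the Lie token
  have hSX := K0AxCtabUniq.chartCfg_unitField_eventuallyEq_expChart_ofRecord F θ K k Ω dom levB Gp Δ2 a hposπ hposb hQ εC B₀ C₄ a₃ j a𝔄 ε₄ htok
  -- the exponent `lieExpo S ∘ W` is `C^ω` at `0`
  have hXc := K0AxCtabUniq.contDiffAt_lieExpo_unitField_ofRecord_of_exp_mem (n := (⊤ : WithTop ℕ∞)) F θ K k Ω dom levB Gp Δ2 a hposπ hposb hQ
    εC B₀ C₄ a₃ j a𝔄 ε₄ hρ hT h1 hWtok ha𝔄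
  exact (K0AxCtabUniq.contDiffAt_recordBgField_entries_of_chart F θ k K _ (K0AxCtabUniq.rootFactorAt_congr F θ k K hfac hSX)
    (K0AxCtabUniq.contDiffAt_coe_expChart_family F θ k K hXc)).analyticAt

/-! ## §2  (B)+(D) AT THE RECORD's LETTERS (`θ := thetaFill F a₀ ε₂₉`, `K := recordK₀ F Mc k + n`): the token package ⟹ the orbit rows (C-orb) AND TokP9reg -/

/-- ★★★ **AT ONE RECORD VOLUME: the scheme-of-record token package ⟹ (∀ a l, (C-orb)) ∧ TokP9reg.**  The package = ✓p823633's explicit binders at `θ := thetaFill F a₀ ε₂₉`, `K := recordK₀ F Mc k + n`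
under ∃ (the four `Fact`s are Node00 THEOREMS ✓`factL` ✓`factEta` ✓`factC0` ✓`wBRec_fact`, bound with `haveI` so the binder types elaborate).  DISCHARGED here: `ρ₈ ∈ 𝔰𝔲(2)` at the fill
(✓`PortU8.ρ8_thetaFill_mem_lieSU`), `k + 2 ≤ m + K` (`1 ≤ m`, `recordK₀ = k + 1 + log_L Mc`).  Orbit rows = ✓p823633's `.2.1` component; TokP9reg = §1.  CONDITIONAL on the displayed package.
[cite: Balaban1985Variational, Thm 1 p.279, Prop. 6 p.295, Prop. 9 p.309, (176)–(178) p.306; Balaban1987RG1, (1.20)–(1.22) p.264, (4.35) p.290] -/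
theorem orbitRows_analytic_of_recordSchemeTokens_at (F : T4Family) (a₀ ε₂₉ : ℝ) (Mc k n : ℕ)
    (hbody :
        letI θ := thetaFill F a₀ ε₂₉; letI := θ.instVβ₁; letI := θ.instVβ₂; letI := θ.instιβ;
        haveI := factL F; haveI := factEta F (recordK₀ F Mc k + n) (k + 1); haveI := factC0 F (recordK₀ F Mc k + n) (k + 1); haveI := wBRec_fact F (recordK₀ F Mc k + n) (k + 1);
        ∃ (Ω : ℕ → Set (Site (F.P (recordK₀ F Mc k + n)) 0)) (dom : Set (GaugeField (F.P (recordK₀ F Mc k + n)) (k + 1) (SU 2))) (levB : PBond (F.P (recordK₀ F Mc k + n)) (k + 1) → ℕ)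
          (Gp : SiteL2K ℂ (F.P (recordK₀ F Mc k + n)).d (fun _ => (F.P (recordK₀ F Mc k + n)).sitesPerDir 0) (c0Rec F (recordK₀ F Mc k + n) (k + 1)) (WRec 2) →ₗ[ℂ]
            SiteL2K ℂ (F.P (recordK₀ F Mc k + n)).d (fun _ => (F.P (recordK₀ F Mc k + n)).sitesPerDir 0) (c0Rec F (recordK₀ F Mc k + n) (k + 1)) (WRec 2))
          (Δ2 : BondL2K ℂ (F.P (recordK₀ F Mc k + n)).d (fun _ => (F.P (recordK₀ F Mc k + n)).sitesPerDir 0) (c0Rec F (recordK₀ F Mc k + n) (k + 1)) (WRec 2) →ₗ[ℂ]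
            BondL2K ℂ (F.P (recordK₀ F Mc k + n)).d (fun _ => (F.P (recordK₀ F Mc k + n)).sitesPerDir 0) (c0Rec F (recordK₀ F Mc k + n) (k + 1)) (WRec 2)) (a : ℝ)
          (hposπ : ∀ x, x ≠ 0 → 0 < RCLike.re ⟪x, laplaceAOfRecordAt F 2 (k + 1) (1 : GaugeField (F.P (recordK₀ F Mc k + n)) 0 (SU 2))
            (hessOpOfRecord128 F 2 (k + 1) (1 : GaugeField (F.P (recordK₀ F Mc k + n)) 0 (SU 2)) Gp (QflatOfRecord F 2 (k + 1)) Δ2)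
            (QOfRecord F 2 (k + 1) (1 : GaugeField (F.P (recordK₀ F Mc k + n)) 0 (SU 2))) (QflatOfRecord F 2 (k + 1)) a x⟫_ℂ)
          (hposb : ∀ x, x ≠ 0 → 0 < RCLike.re ⟪x, laplaceAOfRecord F 2 (k + 1) (1 : GaugeField (F.P (recordK₀ F Mc k + n)) 0 (SU 2))
            (QOfRecord F 2 (k + 1) (1 : GaugeField (F.P (recordK₀ F Mc k + n)) 0 (SU 2))) (QflatOfRecord F 2 (k + 1)) a x⟫_ℂ)
          (hQ : Function.Surjective (QOfRecord F 2 (k + 1) (1 : GaugeField (F.P (recordK₀ F Mc k + n)) 0 (SU 2)))) (εC B₀ C₄ a₃ j a𝔄 ε₄ : ℝ)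
          (S : BgSchemeOnLit F 2 (recordK₀ F Mc k + n) (k + 1) Ω 1)
          (_ : S = bgSchemeOfRecord F 2 (recordK₀ F Mc k + n) (k + 1) Ω 1 dom levB Gp Δ2 a hposπ hposb hQ εC B₀ C₄ a₃ j a𝔄 ε₄)
          (Kc : GaugeField (F.P (recordK₀ F Mc k + n)) (k + 1) (SU 2) → Set (Space115Lit F 2 (recordK₀ F Mc k + n) (k + 1) Ω 1)),
          S.RegimeTok ∧ WAnalyticTok F 2 (recordK₀ F Mc k + n) (k + 1) Ω 1 levB Gp a hposb hQ εC a₃ ∧ 0 < a𝔄 ∧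
          dom ∈ 𝓝 (1 : GaugeField (F.P (recordK₀ F Mc k + n)) (k + 1) (SU 2)) ∧
          (∀ V ∈ S.dom, ∀ A ∈ Kc V, S.chart V A ∈ bgReg F 2 (recordK₀ F Mc k + n) (k + 1) θ.εbg ∧ Averaging.iter (avOfRecord F 2 (recordK₀ F Mc k + n)) (k + 1) (S.chart V A) = V) ∧
          (∀ V ∈ S.dom, ∀ U : GaugeField (F.P (recordK₀ F Mc k + n)) 0 (SU 2), U ∈ bgReg F 2 (recordK₀ F Mc k + n) (k + 1) θ.εbg →
            Averaging.iter (avOfRecord F 2 (recordK₀ F Mc k + n)) (k + 1) U = V → ∃ A ∈ Kc V, OrbitRel (k + 1) (S.chart V A) U) ∧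
          (∀ V ∈ S.dom, ∀ A ∈ Kc V, IsMinOn (wilsonAction4 ∘ S.chart V) (Kc V) A →
            ‖A‖ ≤ S.ε₄ ∧ mapT (S.𝒢 V) 0 (S.W V) (S.J V) (S.𝔄 V) A = A) ∧
          (∀ V ∈ S.dom, S.sol V ∈ Kc V) ∧ (∀ V ∈ S.dom, IsMinOn (wilsonAction4 ∘ S.chart V) (Kc V) (S.sol V)) ∧
          (∀ᶠ B in 𝓝 (0 : recordW F a₀ ε₂₉ k (recordK₀ F Mc k + n)), S.LieTokAt (unitField F θ k (recordK₀ F Mc k + n) B))) :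
    letI θ := thetaFill F a₀ ε₂₉; letI := θ.instVβ₁; letI := θ.instVβ₂; letI := θ.instιβ;
    (∀ (a : θ.ιβ) (l : RespLabel F k (recordK₀ F Mc k + n)), RootedResponseOrbitAt F θ k (recordK₀ F Mc k + n) a l) ∧
    AnalyticAt ℝ (fun B : recordW F a₀ ε₂₉ k (recordK₀ F Mc k + n) => fun (b : PBond (F.P (recordK₀ F Mc k + n)) 0) (i i' : Fin 2) =>
      ((recordBgField F θ k (recordK₀ F Mc k + n) B b : SU 2) : Matrix (Fin 2) (Fin 2) ℂ) i i') 0 := by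
  letI θ := thetaFill F a₀ ε₂₉; letI := θ.instVβ₁; letI := θ.instVβ₂; letI := θ.instιβ
  haveI := factL F; haveI := factEta F (recordK₀ F Mc k + n) (k + 1); haveI := factC0 F (recordK₀ F Mc k + n) (k + 1)
  haveI := wBRec_fact F (recordK₀ F Mc k + n) (k + 1)
  obtain ⟨Ω, dom, levB, Gp, Δ2, a, hposπ, hposb, hQ, εC, B₀, C₄, a₃, j, a𝔄, ε₄, S, hS, Kc, hT, hWtok, ha𝔄, hd, range, covers, sol, star_mem,
    star_min, htok⟩ := hbody
  have hk2 : k + 2 ≤ (F.P (recordK₀ F Mc k + n)).m + (F.P (recordK₀ F Mc k + n)).K := by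
    have hm := F.hm
    simp only [T4Family.P_m, T4Family.P_K, recordK₀]
    omega
  have hρ8 : ∀ v : θ.Vβ, θ.ρ8 v ∈ lieSU (Fin 2) := fun v => PortU8.ρ8_thetaFill_mem_lieSU (F := F) (a₀ := a₀) (ε₂₉ := ε₂₉) v
  exact ⟨fun a' l => ((K0AxCtabUniq.rootedReceipts_of_tokens_atScale_recordScheme_modGauge F θ k _ hk2 Ω dom levB Gp Δ2 a hposπ hposb hQ εC B₀ C₄
      a₃ j a𝔄 ε₄ S hS hT hWtok ha𝔄 hd hρ8 Kc range covers sol star_mem star_min htok).1 a' l).2.1,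
    analyticAt_recordBgField_entries_of_tokens_recordScheme F θ k _ hk2 Ω dom levB Gp Δ2 a hposπ hposb hQ εC B₀ C₄ a₃ j a𝔄 ε₄ S hS hT hWtok
      ha𝔄 hd hρ8 Kc range covers sol star_mem star_min htok⟩

/-! ## §3  (R-Sch) — the package in CEILING-AND-FLOOR shape — supplies (R-Bg) AND (R-Orb) verbatim (✓№18's `hBg`, №19's `hOrbC`) -/

/-- ★★★ **(R-Sch) ⟹ (R-Bg) ∧ (R-Orb), AT ONE FAMILY `F`**: the scheme-of-record token package below a family radius `aS(F)`, above a cube-letter floor `M₀(F, a₀)`, at every `ε₂₉ > 0` and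
every record volume, gives ✓№18's residual receipt (R-Bg) (`hBg` of ✓`joinAntecedentsRadiusFirst_of_residual`, `aB := aS`) and №19's (R-Orb) (`aO := aS`) — pointwise by §2.  CONDITIONAL;
(R-Sch) OPEN Bałaban-strength content inhabited NOWHERE. [cite: Balaban1985Variational, Thm 1 p.279, Prop. 6 p.295, Prop. 9 p.309, (176)–(178) p.306; Balaban1987RG1, (1.22) p.264] -/
theorem residualBg_orbC_of_residualScheme (F : T4Family)
    (hSch :
      ∃ aS : ℝ, 0 < aS ∧ ∀ a₀ : ℝ, 0 < a₀ → a₀ ≤ aS → ∃ M₀ : ℕ, ∀ Mc : ℕ, McGuard F Mc → M₀ ≤ Mc → ∀ ε₂₉ : ℝ, 0 < ε₂₉ → ∀ k n : ℕ,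
        letI θ := thetaFill F a₀ ε₂₉; letI := θ.instVβ₁; letI := θ.instVβ₂; letI := θ.instιβ;
        haveI := factL F; haveI := factEta F (recordK₀ F Mc k + n) (k + 1); haveI := factC0 F (recordK₀ F Mc k + n) (k + 1); haveI := wBRec_fact F (recordK₀ F Mc k + n) (k + 1);
        ∃ (Ω : ℕ → Set (Site (F.P (recordK₀ F Mc k + n)) 0)) (dom : Set (GaugeField (F.P (recordK₀ F Mc k + n)) (k + 1) (SU 2))) (levB : PBond (F.P (recordK₀ F Mc k + n)) (k + 1) → ℕ)
          (Gp : SiteL2K ℂ (F.P (recordK₀ F Mc k + n)).d (fun _ => (F.P (recordK₀ F Mc k + n)).sitesPerDir 0) (c0Rec F (recordK₀ F Mc k + n) (k + 1)) (WRec 2) →ₗ[ℂ]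
            SiteL2K ℂ (F.P (recordK₀ F Mc k + n)).d (fun _ => (F.P (recordK₀ F Mc k + n)).sitesPerDir 0) (c0Rec F (recordK₀ F Mc k + n) (k + 1)) (WRec 2))
          (Δ2 : BondL2K ℂ (F.P (recordK₀ F Mc k + n)).d (fun _ => (F.P (recordK₀ F Mc k + n)).sitesPerDir 0) (c0Rec F (recordK₀ F Mc k + n) (k + 1)) (WRec 2) →ₗ[ℂ]
            BondL2K ℂ (F.P (recordK₀ F Mc k + n)).d (fun _ => (F.P (recordK₀ F Mc k + n)).sitesPerDir 0) (c0Rec F (recordK₀ F Mc k + n) (k + 1)) (WRec 2)) (a : ℝ)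
          (hposπ : ∀ x, x ≠ 0 → 0 < RCLike.re ⟪x, laplaceAOfRecordAt F 2 (k + 1) (1 : GaugeField (F.P (recordK₀ F Mc k + n)) 0 (SU 2))
            (hessOpOfRecord128 F 2 (k + 1) (1 : GaugeField (F.P (recordK₀ F Mc k + n)) 0 (SU 2)) Gp (QflatOfRecord F 2 (k + 1)) Δ2)
            (QOfRecord F 2 (k + 1) (1 : GaugeField (F.P (recordK₀ F Mc k + n)) 0 (SU 2))) (QflatOfRecord F 2 (k + 1)) a x⟫_ℂ)
          (hposb : ∀ x, x ≠ 0 → 0 < RCLike.re ⟪x, laplaceAOfRecord F 2 (k + 1) (1 : GaugeField (F.P (recordK₀ F Mc k + n)) 0 (SU 2))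
            (QOfRecord F 2 (k + 1) (1 : GaugeField (F.P (recordK₀ F Mc k + n)) 0 (SU 2))) (QflatOfRecord F 2 (k + 1)) a x⟫_ℂ)
          (hQ : Function.Surjective (QOfRecord F 2 (k + 1) (1 : GaugeField (F.P (recordK₀ F Mc k + n)) 0 (SU 2)))) (εC B₀ C₄ a₃ j a𝔄 ε₄ : ℝ)
          (S : BgSchemeOnLit F 2 (recordK₀ F Mc k + n) (k + 1) Ω 1)
          (_ : S = bgSchemeOfRecord F 2 (recordK₀ F Mc k + n) (k + 1) Ω 1 dom levB Gp Δ2 a hposπ hposb hQ εC B₀ C₄ a₃ j a𝔄 ε₄)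
          (Kc : GaugeField (F.P (recordK₀ F Mc k + n)) (k + 1) (SU 2) → Set (Space115Lit F 2 (recordK₀ F Mc k + n) (k + 1) Ω 1)),
          S.RegimeTok ∧ WAnalyticTok F 2 (recordK₀ F Mc k + n) (k + 1) Ω 1 levB Gp a hposb hQ εC a₃ ∧ 0 < a𝔄 ∧
          dom ∈ 𝓝 (1 : GaugeField (F.P (recordK₀ F Mc k + n)) (k + 1) (SU 2)) ∧
          (∀ V ∈ S.dom, ∀ A ∈ Kc V, S.chart V A ∈ bgReg F 2 (recordK₀ F Mc k + n) (k + 1) θ.εbg ∧ Averaging.iter (avOfRecord F 2 (recordK₀ F Mc k + n)) (k + 1) (S.chart V A) = V) ∧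
          (∀ V ∈ S.dom, ∀ U : GaugeField (F.P (recordK₀ F Mc k + n)) 0 (SU 2), U ∈ bgReg F 2 (recordK₀ F Mc k + n) (k + 1) θ.εbg →
            Averaging.iter (avOfRecord F 2 (recordK₀ F Mc k + n)) (k + 1) U = V → ∃ A ∈ Kc V, OrbitRel (k + 1) (S.chart V A) U) ∧
          (∀ V ∈ S.dom, ∀ A ∈ Kc V, IsMinOn (wilsonAction4 ∘ S.chart V) (Kc V) A →
            ‖A‖ ≤ S.ε₄ ∧ mapT (S.𝒢 V) 0 (S.W V) (S.J V) (S.𝔄 V) A = A) ∧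
          (∀ V ∈ S.dom, S.sol V ∈ Kc V) ∧ (∀ V ∈ S.dom, IsMinOn (wilsonAction4 ∘ S.chart V) (Kc V) (S.sol V)) ∧
          (∀ᶠ B in 𝓝 (0 : recordW F a₀ ε₂₉ k (recordK₀ F Mc k + n)), S.LieTokAt (unitField F θ k (recordK₀ F Mc k + n) B))) :
    (      ∃ aB : ℝ, 0 < aB ∧ ∀ a₀ : ℝ, 0 < a₀ → a₀ ≤ aB → ∃ M₀ : ℕ, ∀ Mc : ℕ, McGuard F Mc → M₀ ≤ Mc →
        (∀ (k n : ℕ) (ε₂₉ : ℝ), 0 < ε₂₉ → letI θ := thetaFill F a₀ ε₂₉; letI := θ.instVβ₁; letI := θ.instVβ₂; letI := θ.instιβ;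
          AnalyticAt ℝ (fun B : recordW F a₀ ε₂₉ k (recordK₀ F Mc k + n) => fun (b : PBond (F.P (recordK₀ F Mc k + n)) 0) (i i' : Fin 2) =>
            ((recordBgField F θ k (recordK₀ F Mc k + n) B b : SU 2) : Matrix (Fin 2) (Fin 2) ℂ) i i') 0)) ∧
    (      ∃ aO : ℝ, 0 < aO ∧ ∀ a₀ : ℝ, 0 < a₀ → a₀ ≤ aO → ∃ M₀ : ℕ, ∀ Mc : ℕ, McGuard F Mc → M₀ ≤ Mc → ∀ ε₂₉ : ℝ, 0 < ε₂₉ →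
        letI θ := thetaFill F a₀ ε₂₉; letI := θ.instVβ₁; letI := θ.instVβ₂; letI := θ.instιβ;
        (∀ (k n : ℕ) (a : θ.ιβ) (l : RespLabel F k (recordK₀ F Mc k + n)), RootedResponseOrbitAt F θ k (recordK₀ F Mc k + n) a l)) := by
  obtain ⟨aS, haS, hS⟩ := hSch
  refine ⟨⟨aS, haS, fun a₀ ha₀ hle => ?_⟩, ⟨aS, haS, fun a₀ ha₀ hle => ?_⟩⟩
  · obtain ⟨M₀, hM⟩ := hS a₀ ha₀ hle
    exact ⟨M₀, fun Mc hG hMc k n ε₂₉ hε => (orbitRows_analytic_of_recordSchemeTokens_at F a₀ ε₂₉ Mc k n (hM Mc hG hMc ε₂₉ hε k n)).2⟩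
  · obtain ⟨M₀, hM⟩ := hS a₀ ha₀ hle
    exact ⟨M₀, fun Mc hG hMc ε₂₉ hε k n a l => (orbitRows_analytic_of_recordSchemeTokens_at F a₀ ε₂₉ Mc k n (hM Mc hG hMc ε₂₉ hε k n)).1 a l⟩

/-! ## §4  ★★★ THE DOORS WITH THE TOKEN PINNED: K0ᴬ ⟸ ⁸-box ∧ (R-Uk) ∧ (R-Old) ∧ (R-Sch);  junction `hβc` ⟸ cofinal ⁸ ∧ (R-Uk) ∧ (R-Old) ∧ (R-Sch) ∧ (R-Win₁) -/

/-- ★★★ **K0ᴬ BY NAME ⟸ ⁸-ON-THE-BOX ∧ (R-Uk) ∧ (R-Old) ∧ (R-Sch)** — FOUR displayed receipts (was five): the radius-first supply ✓`joinAntecedentsRadiusFirst_of_residual` at `Tok := TokP9L4Old`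
with `hBg := (§3).1`, read at the ceiling `min a aS` and the threshold `max Mth M₀`; ⁸ at the JOIN's letters (thirteenth antecedent = the supplied `TokP9L4Old F Mc a₀` itself); rows
✓`chartRowsBox_of_orbit` from `(§3).2` at `(a₀, Mc, ε₂₉)` + antecedent (12); ✓`record13SepCoPHInhabitedAx_of_chartRowsBox_cofinalRadii` at level `min γ₀ ½`, `Mg := 4·Mc` (№19 §2's
composition verbatim).  CONDITIONAL helper; every displayed hypothesis OPEN Bałaban-strength content inhabited NOWHERE; K0ᴬ 27238 OPEN; nothing of Bałaban discharged; the Yang–Mills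
mass gap is NOT proved. [cite: Balaban1987RG1, Thm 1 p.259, Thm 3 p.264, (1.18)–(1.22) pp.263–264, (4.35)–(4.37) pp.290–291, (5.10) p.293; Balaban1985Variational, Thm 1 (8)–(9) p.279,
Prop. 6 p.295, Prop. 9 p.309, (176)–(178) p.306] -/
theorem record13SepCoPHInhabitedAx_of_sig8LR4Box_uk_old_scheme
    (h8 : ∀ F, Sig8LR4Box F)
    (hUk : ∀ F : T4Family,
      ∃ aU : ℝ, 0 < aU ∧ ∀ (B₃ a₀ a₁ : ℝ), 2 * (F.L : ℝ) ^ 2 ≤ B₃ → 0 < a₀ → a₀ ≤ aU → 0 < a₁ → ∃ M₀ : ℕ, ∀ Mc : ℕ, McGuard F Mc → M₀ ≤ Mc →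
        (∀ ε₁ : ℝ, 0 < ε₁ → ε₁ ≤ a₁ → B₃ * ε₁ ≤ a₀ → ∀ (k n : ℕ) (V : GaugeField (F.P (recordK₀ F Mc k + n)) (k + 1) (SU 2)), PlaqSmall ε₁ V →
          UkExists F 2 (recordK₀ F Mc k + n) (k + 1) a₀ V ∧ UniqueUkOrbit F 2 (recordK₀ F Mc k + n) (k + 1) a₀ V))
    (hOld : ∀ F : T4Family,
      ∃ aT : ℝ, 0 < aT ∧ ∀ a₀ : ℝ, 0 < a₀ → a₀ ≤ aT → ∃ M₀ : ℕ, ∀ Mc : ℕ, McGuard F Mc → M₀ ≤ Mc → TokP9L4Old F Mc a₀)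
    (hSch : ∀ F : T4Family,
      ∃ aS : ℝ, 0 < aS ∧ ∀ a₀ : ℝ, 0 < a₀ → a₀ ≤ aS → ∃ M₀ : ℕ, ∀ Mc : ℕ, McGuard F Mc → M₀ ≤ Mc → ∀ ε₂₉ : ℝ, 0 < ε₂₉ → ∀ k n : ℕ,
        letI θ := thetaFill F a₀ ε₂₉; letI := θ.instVβ₁; letI := θ.instVβ₂; letI := θ.instιβ;
        haveI := factL F; haveI := factEta F (recordK₀ F Mc k + n) (k + 1); haveI := factC0 F (recordK₀ F Mc k + n) (k + 1); haveI := wBRec_fact F (recordK₀ F Mc k + n) (k + 1);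
        ∃ (Ω : ℕ → Set (Site (F.P (recordK₀ F Mc k + n)) 0)) (dom : Set (GaugeField (F.P (recordK₀ F Mc k + n)) (k + 1) (SU 2))) (levB : PBond (F.P (recordK₀ F Mc k + n)) (k + 1) → ℕ)
          (Gp : SiteL2K ℂ (F.P (recordK₀ F Mc k + n)).d (fun _ => (F.P (recordK₀ F Mc k + n)).sitesPerDir 0) (c0Rec F (recordK₀ F Mc k + n) (k + 1)) (WRec 2) →ₗ[ℂ]
            SiteL2K ℂ (F.P (recordK₀ F Mc k + n)).d (fun _ => (F.P (recordK₀ F Mc k + n)).sitesPerDir 0) (c0Rec F (recordK₀ F Mc k + n) (k + 1)) (WRec 2))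
          (Δ2 : BondL2K ℂ (F.P (recordK₀ F Mc k + n)).d (fun _ => (F.P (recordK₀ F Mc k + n)).sitesPerDir 0) (c0Rec F (recordK₀ F Mc k + n) (k + 1)) (WRec 2) →ₗ[ℂ]
            BondL2K ℂ (F.P (recordK₀ F Mc k + n)).d (fun _ => (F.P (recordK₀ F Mc k + n)).sitesPerDir 0) (c0Rec F (recordK₀ F Mc k + n) (k + 1)) (WRec 2)) (a : ℝ)
          (hposπ : ∀ x, x ≠ 0 → 0 < RCLike.re ⟪x, laplaceAOfRecordAt F 2 (k + 1) (1 : GaugeField (F.P (recordK₀ F Mc k + n)) 0 (SU 2))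
            (hessOpOfRecord128 F 2 (k + 1) (1 : GaugeField (F.P (recordK₀ F Mc k + n)) 0 (SU 2)) Gp (QflatOfRecord F 2 (k + 1)) Δ2)
            (QOfRecord F 2 (k + 1) (1 : GaugeField (F.P (recordK₀ F Mc k + n)) 0 (SU 2))) (QflatOfRecord F 2 (k + 1)) a x⟫_ℂ)
          (hposb : ∀ x, x ≠ 0 → 0 < RCLike.re ⟪x, laplaceAOfRecord F 2 (k + 1) (1 : GaugeField (F.P (recordK₀ F Mc k + n)) 0 (SU 2))
            (QOfRecord F 2 (k + 1) (1 : GaugeField (F.P (recordK₀ F Mc k + n)) 0 (SU 2))) (QflatOfRecord F 2 (k + 1)) a x⟫_ℂ)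
          (hQ : Function.Surjective (QOfRecord F 2 (k + 1) (1 : GaugeField (F.P (recordK₀ F Mc k + n)) 0 (SU 2)))) (εC B₀ C₄ a₃ j a𝔄 ε₄ : ℝ)
          (S : BgSchemeOnLit F 2 (recordK₀ F Mc k + n) (k + 1) Ω 1)
          (_ : S = bgSchemeOfRecord F 2 (recordK₀ F Mc k + n) (k + 1) Ω 1 dom levB Gp Δ2 a hposπ hposb hQ εC B₀ C₄ a₃ j a𝔄 ε₄)
          (Kc : GaugeField (F.P (recordK₀ F Mc k + n)) (k + 1) (SU 2) → Set (Space115Lit F 2 (recordK₀ F Mc k + n) (k + 1) Ω 1)),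
          S.RegimeTok ∧ WAnalyticTok F 2 (recordK₀ F Mc k + n) (k + 1) Ω 1 levB Gp a hposb hQ εC a₃ ∧ 0 < a𝔄 ∧
          dom ∈ 𝓝 (1 : GaugeField (F.P (recordK₀ F Mc k + n)) (k + 1) (SU 2)) ∧
          (∀ V ∈ S.dom, ∀ A ∈ Kc V, S.chart V A ∈ bgReg F 2 (recordK₀ F Mc k + n) (k + 1) θ.εbg ∧ Averaging.iter (avOfRecord F 2 (recordK₀ F Mc k + n)) (k + 1) (S.chart V A) = V) ∧
          (∀ V ∈ S.dom, ∀ U : GaugeField (F.P (recordK₀ F Mc k + n)) 0 (SU 2), U ∈ bgReg F 2 (recordK₀ F Mc k + n) (k + 1) θ.εbg →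
            Averaging.iter (avOfRecord F 2 (recordK₀ F Mc k + n)) (k + 1) U = V → ∃ A ∈ Kc V, OrbitRel (k + 1) (S.chart V A) U) ∧
          (∀ V ∈ S.dom, ∀ A ∈ Kc V, IsMinOn (wilsonAction4 ∘ S.chart V) (Kc V) A →
            ‖A‖ ≤ S.ε₄ ∧ mapT (S.𝒢 V) 0 (S.W V) (S.J V) (S.𝔄 V) A = A) ∧
          (∀ V ∈ S.dom, S.sol V ∈ Kc V) ∧ (∀ V ∈ S.dom, IsMinOn (wilsonAction4 ∘ S.chart V) (Kc V) (S.sol V)) ∧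
          (∀ᶠ B in 𝓝 (0 : recordW F a₀ ε₂₉ k (recordK₀ F Mc k + n)), S.LieTokAt (unitField F θ k (recordK₀ F Mc k + n) B))) :
    Summit.QuantumFields.YangMills.Theses.BalabanUVNodes.Record13SepCoPHInhabitedAx := by
  refine record13SepCoPHInhabitedAx_of_chartRowsBox_cofinalRadii fun F a ha => ?_
  obtain ⟨Mth, h8F⟩ := h8 F
  obtain ⟨hBg, aO, haO, hO⟩ := residualBg_orbC_of_residualScheme F (hSch F)
  obtain ⟨a₀, ha₀', hle, hAM⟩ := joinAntecedentsRadiusFirst_of_residual TokP9L4Old F (hUk F) hBg (hOld F) (min a aO) (lt_min ha haO)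
  obtain ⟨MO, hMO⟩ := hO a₀ ha₀' (hle.trans (min_le_right _ _))
  obtain ⟨Mc, hMc, j, c, c₀, c₁, B₃, B₃', a₁, hAnt⟩ := hAM (max Mth MO)
  obtain ⟨hG0, hc, hc₀, hc₁, hB₃, hB₃', ha₀, ha₁, hThm, hGauge, hUk', hBg', hP9⟩ := hAnt
  obtain ⟨γ₀, ε₂₉, E₀, κ, α₀, α₁, hγ₀, hε, hE₀, hκ, hα₀, hα₁, hD⟩ :=
    h8F Mc ((le_max_left _ _).trans hMc) j c c₀ c₁ B₃ B₃' a₀ a₁ hG0 hc hc₀ hc₁ hB₃ hB₃' ha₀ ha₁ hThm hGauge hUk' hBg' hP9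
  letI θ := thetaFill F a₀ ε₂₉; letI := θ.instVβ₁; letI := θ.instVβ₂; letI := θ.instιβ
  obtain ⟨ιC, hsw, h9⟩ :=
    chartRowsBox_of_orbit F Mc a₀ ε₂₉ ha₀ (hMO Mc hG0 ((le_max_right _ _).trans hMc) ε₂₉ hε) fun k n => (hBg' k n ε₂₉ hε).contDiffAt
  refine ⟨a₀, ha₀, hle.trans (min_le_left _ _), min γ₀ (1 / 2), ε₂₉, E₀, κ, 4 * (Mc : ℝ), α₀, α₁, Mc, lt_min hγ₀ (by norm_num), min_le_right _ _, hε,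
    hE₀, hκ, hα₀, hα₁, hG0, le_rfl, ιC, fun k v hv => hD k v ?_, hsw, h9⟩
  exact mem_box.mpr fun i => ⟨(mem_box.mp hv i).1, (mem_box.mp hv i).2.trans (min_le_left _ _)⟩

/-- ★★★ **THE JUNCTION's BINDER `hβc` VERBATIM ⟸ cofinal ⁸ ∧ (R-Uk) ∧ (R-Old) ∧ (R-Sch) ∧ (R-Win₁)**: №19 §3's order of reading with `hBg := (§3).1`, `hOrbC := (§3).2`, `Tok := TokP9L4Old`:
radius `a₀ ≤ min a (min aS aW)` from ✓`joinAntecedentsRadiusFirst_of_residual`; window `(εw, γw)` at `a₀`; ⁸-below at `εw` → `Mth`; (R-Sch)'s floor at `a₀`; supply at `max Mth M₀` → `Mc`,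
the thirteen antecedents; ⁸ at the JOIN's letters → `ε₂₉ ≤ εw`, `γ₀`; rows ✓`chartRowsBox_of_orbit` + antecedent (12); the two letters at `(ε₂₉, γw)` restricted to `min γ₀ γw`
(`ContinuousOn.mono` ∘ ✓`box_mono`); ✓`cofinalBetaSocketAxBody_of_chartRowsBox_hessBox_negPart` at `a₀ ≤ a`, level `min γ₀ γw ≤ ½`, `Mg := 4·Mc`.  CONDITIONAL; every hypothesis OPEN
Bałaban-strength content inhabited NOWHERE; the junction's consumer, K0ᴬ 27238, K1ᴬ 27239 remain OPEN; NODE O 0∕1; the Yang–Mills mass gap is NOT proved.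
[cite: Balaban1987RG1, Thm 2 (0.31) p.259, Thm 3 p.264, (1.18)–(1.22) pp.263–264, (4.35) p.290, (5.38)–(5.44) pp.296–297; Balaban1985Variational, Thm 1 (8)–(9) p.279, Prop. 6 p.295,
Prop. 9 p.309, (176)–(178) p.306] -/
theorem cofinalBetaSocketAxBody_allRadii_of_sig8LR4BoxCofinal_uk_old_scheme_winC
    (h8c : ∀ (F : T4Family) (εw : ℝ), 0 < εw → Sig8LR4BoxBelow F εw)
    (hUk : ∀ F : T4Family,
      ∃ aU : ℝ, 0 < aU ∧ ∀ (B₃ a₀ a₁ : ℝ), 2 * (F.L : ℝ) ^ 2 ≤ B₃ → 0 < a₀ → a₀ ≤ aU → 0 < a₁ → ∃ M₀ : ℕ, ∀ Mc : ℕ, McGuard F Mc → M₀ ≤ Mc →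
        (∀ ε₁ : ℝ, 0 < ε₁ → ε₁ ≤ a₁ → B₃ * ε₁ ≤ a₀ → ∀ (k n : ℕ) (V : GaugeField (F.P (recordK₀ F Mc k + n)) (k + 1) (SU 2)), PlaqSmall ε₁ V →
          UkExists F 2 (recordK₀ F Mc k + n) (k + 1) a₀ V ∧ UniqueUkOrbit F 2 (recordK₀ F Mc k + n) (k + 1) a₀ V))
    (hOld : ∀ F : T4Family,
      ∃ aT : ℝ, 0 < aT ∧ ∀ a₀ : ℝ, 0 < a₀ → a₀ ≤ aT → ∃ M₀ : ℕ, ∀ Mc : ℕ, McGuard F Mc → M₀ ≤ Mc → TokP9L4Old F Mc a₀)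
    (hSch : ∀ F : T4Family,
      ∃ aS : ℝ, 0 < aS ∧ ∀ a₀ : ℝ, 0 < a₀ → a₀ ≤ aS → ∃ M₀ : ℕ, ∀ Mc : ℕ, McGuard F Mc → M₀ ≤ Mc → ∀ ε₂₉ : ℝ, 0 < ε₂₉ → ∀ k n : ℕ,
        letI θ := thetaFill F a₀ ε₂₉; letI := θ.instVβ₁; letI := θ.instVβ₂; letI := θ.instιβ;
        haveI := factL F; haveI := factEta F (recordK₀ F Mc k + n) (k + 1); haveI := factC0 F (recordK₀ F Mc k + n) (k + 1); haveI := wBRec_fact F (recordK₀ F Mc k + n) (k + 1);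
        ∃ (Ω : ℕ → Set (Site (F.P (recordK₀ F Mc k + n)) 0)) (dom : Set (GaugeField (F.P (recordK₀ F Mc k + n)) (k + 1) (SU 2))) (levB : PBond (F.P (recordK₀ F Mc k + n)) (k + 1) → ℕ)
          (Gp : SiteL2K ℂ (F.P (recordK₀ F Mc k + n)).d (fun _ => (F.P (recordK₀ F Mc k + n)).sitesPerDir 0) (c0Rec F (recordK₀ F Mc k + n) (k + 1)) (WRec 2) →ₗ[ℂ]
            SiteL2K ℂ (F.P (recordK₀ F Mc k + n)).d (fun _ => (F.P (recordK₀ F Mc k + n)).sitesPerDir 0) (c0Rec F (recordK₀ F Mc k + n) (k + 1)) (WRec 2))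
          (Δ2 : BondL2K ℂ (F.P (recordK₀ F Mc k + n)).d (fun _ => (F.P (recordK₀ F Mc k + n)).sitesPerDir 0) (c0Rec F (recordK₀ F Mc k + n) (k + 1)) (WRec 2) →ₗ[ℂ]
            BondL2K ℂ (F.P (recordK₀ F Mc k + n)).d (fun _ => (F.P (recordK₀ F Mc k + n)).sitesPerDir 0) (c0Rec F (recordK₀ F Mc k + n) (k + 1)) (WRec 2)) (a : ℝ)
          (hposπ : ∀ x, x ≠ 0 → 0 < RCLike.re ⟪x, laplaceAOfRecordAt F 2 (k + 1) (1 : GaugeField (F.P (recordK₀ F Mc k + n)) 0 (SU 2))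
            (hessOpOfRecord128 F 2 (k + 1) (1 : GaugeField (F.P (recordK₀ F Mc k + n)) 0 (SU 2)) Gp (QflatOfRecord F 2 (k + 1)) Δ2)
            (QOfRecord F 2 (k + 1) (1 : GaugeField (F.P (recordK₀ F Mc k + n)) 0 (SU 2))) (QflatOfRecord F 2 (k + 1)) a x⟫_ℂ)
          (hposb : ∀ x, x ≠ 0 → 0 < RCLike.re ⟪x, laplaceAOfRecord F 2 (k + 1) (1 : GaugeField (F.P (recordK₀ F Mc k + n)) 0 (SU 2))
            (QOfRecord F 2 (k + 1) (1 : GaugeField (F.P (recordK₀ F Mc k + n)) 0 (SU 2))) (QflatOfRecord F 2 (k + 1)) a x⟫_ℂ)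
          (hQ : Function.Surjective (QOfRecord F 2 (k + 1) (1 : GaugeField (F.P (recordK₀ F Mc k + n)) 0 (SU 2)))) (εC B₀ C₄ a₃ j a𝔄 ε₄ : ℝ)
          (S : BgSchemeOnLit F 2 (recordK₀ F Mc k + n) (k + 1) Ω 1)
          (_ : S = bgSchemeOfRecord F 2 (recordK₀ F Mc k + n) (k + 1) Ω 1 dom levB Gp Δ2 a hposπ hposb hQ εC B₀ C₄ a₃ j a𝔄 ε₄)
          (Kc : GaugeField (F.P (recordK₀ F Mc k + n)) (k + 1) (SU 2) → Set (Space115Lit F 2 (recordK₀ F Mc k + n) (k + 1) Ω 1)),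
          S.RegimeTok ∧ WAnalyticTok F 2 (recordK₀ F Mc k + n) (k + 1) Ω 1 levB Gp a hposb hQ εC a₃ ∧ 0 < a𝔄 ∧
          dom ∈ 𝓝 (1 : GaugeField (F.P (recordK₀ F Mc k + n)) (k + 1) (SU 2)) ∧
          (∀ V ∈ S.dom, ∀ A ∈ Kc V, S.chart V A ∈ bgReg F 2 (recordK₀ F Mc k + n) (k + 1) θ.εbg ∧ Averaging.iter (avOfRecord F 2 (recordK₀ F Mc k + n)) (k + 1) (S.chart V A) = V) ∧
          (∀ V ∈ S.dom, ∀ U : GaugeField (F.P (recordK₀ F Mc k + n)) 0 (SU 2), U ∈ bgReg F 2 (recordK₀ F Mc k + n) (k + 1) θ.εbg →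
            Averaging.iter (avOfRecord F 2 (recordK₀ F Mc k + n)) (k + 1) U = V → ∃ A ∈ Kc V, OrbitRel (k + 1) (S.chart V A) U) ∧
          (∀ V ∈ S.dom, ∀ A ∈ Kc V, IsMinOn (wilsonAction4 ∘ S.chart V) (Kc V) A →
            ‖A‖ ≤ S.ε₄ ∧ mapT (S.𝒢 V) 0 (S.W V) (S.J V) (S.𝔄 V) A = A) ∧
          (∀ V ∈ S.dom, S.sol V ∈ Kc V) ∧ (∀ V ∈ S.dom, IsMinOn (wilsonAction4 ∘ S.chart V) (Kc V) (S.sol V)) ∧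
          (∀ᶠ B in 𝓝 (0 : recordW F a₀ ε₂₉ k (recordK₀ F Mc k + n)), S.LieTokAt (unitField F θ k (recordK₀ F Mc k + n) B)))
    (hWinC : ∀ F : T4Family,
      ∃ aW : ℝ, 0 < aW ∧ ∀ a₀ : ℝ, 0 < a₀ → a₀ ≤ aW → ∃ εw γw : ℝ, 0 < εw ∧ 0 < γw ∧ γw ≤ 1 / 2 ∧ ∀ ε₂₉ : ℝ, 0 < ε₂₉ → ε₂₉ ≤ εw →
        (letI θ := thetaFill F a₀ ε₂₉; letI := θ.instVβ₁; letI := θ.instVβ₂; letI := θ.instιβ;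
         (∀ k K : ℕ, ContinuousOn (fun v : Fin (k + 1) → ℝ => fderiv ℝ (fderiv ℝ (B12PolarizationTensor120.expChart (recordTermsAx F a₀ ε₂₉ k v K) θ.ρ8)) 0) (FlowStep.Box γw k))) ∧
         ∃ e : ℕ → ℝ, RecordPlimMomentNegPartOnBoxAx F a₀ ε₂₉ γw e) :
    ∀ F : T4Family, ∀ a : ℝ, 0 < a → CofinalBetaSocketAxBody F a := by
  intro F a ha
  obtain ⟨hBg, aO, haO, hO⟩ := residualBg_orbC_of_residualScheme F (hSch F)
  obtain ⟨aW, haW, hWa⟩ := hWinC F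
  obtain ⟨a₀, ha₀', hle, hAM⟩ :=
    joinAntecedentsRadiusFirst_of_residual TokP9L4Old F (hUk F) hBg (hOld F) (min a (min aO aW)) (lt_min ha (lt_min haO haW))
  have hleA : a₀ ≤ a := hle.trans (min_le_left _ _)
  have hleO : a₀ ≤ aO := hle.trans ((min_le_right _ _).trans (min_le_left _ _))
  have hleW : a₀ ≤ aW := hle.trans ((min_le_right _ _).trans (min_le_right _ _))
  obtain ⟨εw, γw, hεw, hγw, hγh, hW⟩ := hWa a₀ ha₀' hleW
  obtain ⟨Mth, h8F⟩ := h8c F εw hεw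
  obtain ⟨MO, hMO⟩ := hO a₀ ha₀' hleO
  obtain ⟨Mc, hMc, j, c, c₀, c₁, B₃, B₃', a₁, hAnt⟩ := hAM (max Mth MO)
  obtain ⟨hG0, hc, hc₀, hc₁, hB₃, hB₃', ha₀, ha₁, hThm, hGauge, hUk', hBg', hP9⟩ := hAnt
  obtain ⟨γ₀, ε₂₉, E₀, κ, α₀, α₁, hγ₀, hε, hεle, hE₀, hκ, hα₀, hα₁, hD⟩ :=
    h8F Mc ((le_max_left _ _).trans hMc) j c c₀ c₁ B₃ B₃' a₀ a₁ hG0 hc hc₀ hc₁ hB₃ hB₃' ha₀ ha₁ hThm hGauge hUk' hBg' hP9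
  letI θ := thetaFill F a₀ ε₂₉; letI := θ.instVβ₁; letI := θ.instVβ₂; letI := θ.instιβ
  obtain ⟨ιC, hsw, h9⟩ :=
    chartRowsBox_of_orbit F Mc a₀ ε₂₉ ha₀ (hMO Mc hG0 ((le_max_right _ _).trans hMc) ε₂₉ hε) fun k n => (hBg' k n ε₂₉ hε).contDiffAt
  obtain ⟨hH, e, hN⟩ := hW ε₂₉ hε hεle
  -- ⁸'s level and the window's single level, met at `min γ₀ γw`
  have hγ₁ : 0 < min γ₀ γw := lt_min hγ₀ hγw
  have hγh' : min γ₀ γw ≤ 1 / 2 := (min_le_right _ _).trans hγh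
  have hN' : RecordPlimMomentNegPartOnBoxAx F a₀ ε₂₉ (min γ₀ γw) e :=
    ⟨hN.1, hN.2.1, fun k v hv => hN.2.2 k v (box_mono (min_le_right _ _) k hv)⟩
  refine cofinalBetaSocketAxBody_of_chartRowsBox_hessBox_negPart (Mg := 4 * (Mc : ℝ)) hE₀ hκ F a₀ ε₂₉ (min γ₀ γw) α₀ α₁ ha₀ hleA hγ₁ hγh' hε
    hα₀ hα₁ Mc hG0 le_rfl ιC (fun k v hv => hD k v ?_) hsw h9 (fun k K => (hH k K).mono (box_mono (min_le_right _ _) k)) hN'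
  exact mem_box.mpr fun i => ⟨(mem_box.mp hv i).1, (mem_box.mp hv i).2.trans (min_le_left _ _)⟩

-- standard axioms only
#print axioms analyticAt_recordBgField_entries_of_tokens_recordScheme
#print axioms orbitRows_analytic_of_recordSchemeTokens_at
#print axioms residualBg_orbC_of_residualScheme
#print axioms record13SepCoPHInhabitedAx_of_sig8LR4Box_uk_old_scheme
#print axioms cofinalBetaSocketAxBody_allRadii_of_sig8LR4BoxCofinal_uk_old_scheme_winC

end Summit.QuantumFields.YangMills.Theorems.K0AxJoinResidualBoxScheme
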